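import Summits.BirchSwinnertonDyer.Rank1Residual.X11b.BDPRouteOpenInputIntFrame
import Summits.BirchSwinnertonDyer.Rank1Residual.X11b.BDPRouteOpenInputSplit
import HarnessLib

/-!
# Route `ErratumRoadFive` (K2, `p ≥ 5`) — the ORIENTATION-REPAIRED CLASSICAL-DATA divisibility atoms
# `P2.IMCDivSomeFrameOnTreeB` ((2.4)∃♭) and `P2.IMCDivIntFrameOnTreeB` (H∃♭): X-slot at the prime OPPOSITE to
# the frame's (ORIENT-AUDIT-19270 form (a); census addendum A-3 of bdp g16, STATUS 04:47Z)

Cell `bsd-stepL` (run/shared/lean/pub/bsd-stepL/), seat `bsd-stepL-bdp` (prover g16, 2026-08-27).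
`--supports stmt-BirchSwinnertonDyer-19702 --as helper`. Two definitions with bodies (`@[conjecture]`, OPEN
named inputs in the tree's vocabulary — obligation nodes, NOT vendored facts) and two bookkeeping theorems; no
named fact, no `sorry`.

WHY. The cell's audit of record (ORIENT-AUDIT-19270 b8dcdfb3, referee g38 ∕ g39, orient-a1 834d52d6, plan g30
RULINGS 1–4) found the ERRATUM-data atoms and `Three.IMCDivAt₃` mis-oriented (family A: the Selmer X-slot at the
frame's own prime, while the tree's precomposition `XAc` pairs a frame at `(ι′, 𝔭)` with `X_ac` strict at `𝔭̄`).
Census addendum A-3 (this seat): multr1-p2's CLASSICAL-Heegner-data atoms `P2.IMCDivSomeFrameOnTree` ((2.4)∃♭,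
`BDPRouteOpenInputSplit.lean`) and `P2.IMCDivIntFrameOnTree` (H∃♭, `BDPRouteOpenInputIntFrame.lean`) have the same
layout (frame `R1.IsBDPLFunctionInt p ι' 𝔭_{ι′} …` ∧ `XAc.charIdeal … 𝔭_{ι′} ∅ γ`), and the REGISTERED deciding
stub of crux (T) 19702, `stub_t_imcDivSomeFrame`, concludes the former. Repair form (a), verbatim as for the other
atoms: every binder, the frame and the value conjunct UNCHANGED; the divisibility conjunct becomes
`∀ 𝔭bar ∋ p, 𝔭bar ≠ 𝔭_{ι′} → Ch_Λ(X_ac 𝔭bar)·𝓞_{ℂ_p}⟦T⟧ ⊆ (Q)` (two primes: frame at `𝔭_{ι′}`, X at `𝔭bar`;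
for the datum's imaginary quadratic `K`, in which `p ∣ N` splits by the Heegner hypothesis, `𝔭bar` is the
conjugate prime).

* `P2.IMCDivSomeFrameOnTreeB W p` — (2.4)∃♭ ORIENTED; `P2.IMCDivIntFrameOnTreeB W p` — H∃♭ ORIENTED (value
  conjunct `R1.BDPValueAtOneIntAt W p e P' Q (a_p)` at the FRAME's prime, untouched);
* `P2.imcDivSomeFrameOnTreeB_of_imcDivIntFrameB` (forget the value), `P2.imcDivSomeFrameOnTreeB_of_forall_prime`
  (a prime-blind supplier serves the atom).
The T = 0 re-thread (`P2OpenInputOnTreeAt` ⟸ H∃♭ᴮ, CTL at the X-prime + log symmetry `𝔭 ↔ 𝔭̄` in rank one) and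
the (T)-branch reduction over the B-atom are the companion `Theorems/ErratumRoadFiveRest3TorsionBranchB.lean`.

HONEST FRAMING: definitions and implications; (2.4)∃♭ ∕ H∃♭ are OPEN in either orientation (no printed
supplier at these data); nothing is discharged, booked or re-labelled (T7); the A-atoms and every theorem
concluding them stay in the tree as correct implications.
References: [Castella2018] §1 (1.b), Thm. 3.1 display (3.2), Thm. 3.2 (arXiv:1704.06608 pp. 3, 9);
[Castella2018Erratum] (2.4) (p. 4); [KellerYin2024] Def. 3.4.1 ∕ Thm. 3.5.1; [CastellaGrossiLeeSkinner2022] §2.3;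
cell audit ORIENT-AUDIT-19270 Q4 (a), RULING 4 (two-prime rule).
-/

noncomputable section

open scoped Classical NumberField

open WeierstrassCurve NumberField IsDedekindDomain Field PowerSeries
open Literature.NumberTheory.EllipticCurves Literature.NumberTheory.EllipticCurves.GreenbergSelmer
open Literature.NumberTheory.EllipticCurves.ModularForms
open Literature.NumberTheory.EllipticCurves.Rank1Residual
open Literature.NumberTheory.EllipticCurves.Castella2018
open Literature.NumberTheory.GaloisRepresentations Literature.NumberTheory.GaloisCohomology
open Summit.BirchSwinnertonDyer.Rank1Residual.X11b.AcSelmer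
open Summit.BirchSwinnertonDyer.Rank1Residual.X11b.Halves

namespace Summit.BirchSwinnertonDyer.Rank1Residual.X11b

section Shape

variable (W : WeierstrassCurve ℚ) [W.IsElliptic] [W.IsGloballyMinimal] (p : ℕ) [Fact p.Prime]

/-- **(2.4)∃♭ ORIENTED — route p2's open divisibility for SOME BDP frame, the Selmer X-slot at the prime
OPPOSITE to the frame's** (repair form (a) of ORIENT-AUDIT-19270 applied to `P2.IMCDivSomeFrameOnTree`): at every
classical Heegner datum (binders VERBATIM), THERE IS a frame `(Ω_K ≠ 0, ‖Ω_p‖ = 1, Q ∈ 𝓞_{ℂ_p}⟦T⟧)` with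
Castella's interpolation property at `(ι', 𝔭_{ι'})` such that for EVERY prime `𝔭bar ∋ p` of `K` with
`𝔭bar ≠ 𝔭_{ι'}`: `Ch_Λ(X_ac^∅ 𝔭bar)·𝓞_{ℂ_p}⟦T⟧ ⊆ (Q)`. OPEN; a predicate on `(W, p)`; nothing asserted.
[cite: Castella2018, §1 (1.b) (arXiv:1704.06608 p. 3) and Thm. 3.1, display (3.2) (p. 9) (shape only; nothing asserted)]
[cite: Castella2018Erratum, (2.4) (p. 4) (display transcribed, X-slot at the conjugate prime; nothing asserted)] -/
@[conjecture]
def P2.IMCDivSomeFrameOnTreeB : Prop :=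
  ∀ (N : ℕ) [NeZero N] (K : Type) [Field K] [NumberField K]
    (Dt : ModularParametrizationData W N) (H : HeegnerDatum N (NumberField.discr K)) (ι : K →+* ℂ)
    (P : (W.baseChange K).toAffine.Point),
    ClassX11b W p → 5 ≤ p → Surj W p → W.conductorNorm ℤ = N → IsImaginaryQuadratic K →
    Odd (NumberField.discr K) → ¬ (p : ℤ) ∣ NumberField.discr K → ¬ p ∣ Units.torsionOrder K →
    SatisfiesHeegnerHypothesis N K →
    (W.quadraticTwist (NumberField.discr K : ℚ)).entireLFunction 1 ≠ 0 →
    WeierstrassCurve.Affine.Point.map ι.toRatAlgHom P = heegnerPointComplex Dt H →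
    ¬ (p : ℤ) ∣ Dt.c → ¬ IsOfFinAddOrder P →
    ∀ (κ : ZpExtension K p), κ.IsAnticyclotomic →
      ∀ (γ : Field.absoluteGaloisGroup K) [Fact (κ.IsTopGenerator γ)]
        (ι' : PadicAlgCl p ≃+* ℂ) (w₀ : InfinitePlace K) (P' : (W.baseChange K).toAffine.Point),
        WeierstrassCurve.Affine.Point.map w₀.embedding.toRatAlgHom P' = heegnerPointComplex Dt H →
        ∀ (e : K →+* ℚ_[p]),
          (∀ k : 𝓞 K, k ∈ (primeOfEmbeddingDatum p ι' w₀.embedding).asIdeal ↔ ‖e (k : K)‖ < 1) →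
          ∃ (ΩK : ℂ) (Ωp : ℂ_[p]) (Q : PowerSeries 𝓞_ℂ_[p]), ΩK ≠ 0 ∧ ‖Ωp‖ = 1 ∧
            R1.IsBDPLFunctionInt p ι' (primeOfEmbeddingDatum p ι' w₀.embedding) κ γ Dt.f ΩK Ωp Q ∧
            ∀ (𝔭bar : HeightOneSpectrum (𝓞 K)), ((p : ℕ) : 𝓞 K) ∈ 𝔭bar.asIdeal →
              𝔭bar ≠ primeOfEmbeddingDatum p ι' w₀.embedding →
              (XAc.charIdeal (W.baseChange K) p κ 𝔭bar ∅ γ).map (PowerSeries.map (R1.toCpInt p)) ≤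
                Ideal.span {Q}

/-- **H∃♭ ORIENTED — frame ∧ value at `𝟙` ∧ divisibility at the OPPOSITE prime** (repair form (a) applied to
`P2.IMCDivIntFrameOnTree`; the value conjunct `R1.BDPValueAtOneIntAt W p e P' Q (a_p(E))` reads the logarithm
through `e` inducing the FRAME's prime `𝔭_{ι'}` and is unchanged). OPEN; nothing asserted.
[cite: Castella2018, Thm. 3.1, display (3.2) and Thm. 3.2 (arXiv:1704.06608 p. 9) (shape only; nothing asserted)]
[cite: Castella2018Erratum, (2.4) (p. 4) (display transcribed, X-slot at the conjugate prime; nothing asserted)] -/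
@[conjecture]
def P2.IMCDivIntFrameOnTreeB : Prop :=
  ∀ (N : ℕ) [NeZero N] (K : Type) [Field K] [NumberField K]
    (Dt : ModularParametrizationData W N) (H : HeegnerDatum N (NumberField.discr K)) (ι : K →+* ℂ)
    (P : (W.baseChange K).toAffine.Point),
    ClassX11b W p → 5 ≤ p → Surj W p → W.conductorNorm ℤ = N → IsImaginaryQuadratic K →
    Odd (NumberField.discr K) → ¬ (p : ℤ) ∣ NumberField.discr K → ¬ p ∣ Units.torsionOrder K →
    SatisfiesHeegnerHypothesis N K →
    (W.quadraticTwist (NumberField.discr K : ℚ)).entireLFunction 1 ≠ 0 →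
    WeierstrassCurve.Affine.Point.map ι.toRatAlgHom P = heegnerPointComplex Dt H →
    ¬ (p : ℤ) ∣ Dt.c → ¬ IsOfFinAddOrder P →
    ∀ (κ : ZpExtension K p), κ.IsAnticyclotomic →
      ∀ (γ : Field.absoluteGaloisGroup K) [Fact (κ.IsTopGenerator γ)]
        (ι' : PadicAlgCl p ≃+* ℂ) (w₀ : InfinitePlace K) (P' : (W.baseChange K).toAffine.Point),
        WeierstrassCurve.Affine.Point.map w₀.embedding.toRatAlgHom P' = heegnerPointComplex Dt H →
        ∀ (e : K →+* ℚ_[p]),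
          (∀ k : 𝓞 K, k ∈ (primeOfEmbeddingDatum p ι' w₀.embedding).asIdeal ↔ ‖e (k : K)‖ < 1) →
          ∃ (ΩK : ℂ) (Ωp : ℂ_[p]) (Q : PowerSeries 𝓞_ℂ_[p]), ΩK ≠ 0 ∧ ‖Ωp‖ = 1 ∧
            R1.IsBDPLFunctionInt p ι' (primeOfEmbeddingDatum p ι' w₀.embedding) κ γ Dt.f ΩK Ωp Q ∧
            R1.BDPValueAtOneIntAt W p e P' Q (W.LFunction p) ∧
            ∀ (𝔭bar : HeightOneSpectrum (𝓞 K)), ((p : ℕ) : 𝓞 K) ∈ 𝔭bar.asIdeal →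
              𝔭bar ≠ primeOfEmbeddingDatum p ι' w₀.embedding →
              (XAc.charIdeal (W.baseChange K) p κ 𝔭bar ∅ γ).map (PowerSeries.map (R1.toCpInt p)) ≤
                Ideal.span {Q}

end Shape

section Weaker

variable {W : WeierstrassCurve ℚ} [W.IsElliptic] [W.IsGloballyMinimal] {p : ℕ} [Fact p.Prime]

/-- H∃♭ᴮ ⟹ (2.4)∃♭ᴮ (forget the value conjunct). [folklore] -/
theorem P2.imcDivSomeFrameOnTreeB_of_imcDivIntFrameB (hF : P2.IMCDivIntFrameOnTreeB W p) :
    P2.IMCDivSomeFrameOnTreeB W p := by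
  intro N _ K _ _ Dt H ι P hX h5 hs hN hK hodd hpd hμ hHN hLt hP hc hPinf κ hκ γ _ ι' w₀ P' hP' e he
  obtain ⟨ΩK, Ωp, Q, hΩK, hΩp, hQ, -, hdiv⟩ :=
    hF N K Dt H ι P hX h5 hs hN hK hodd hpd hμ hHN hLt hP hc hPinf κ hκ γ ι' w₀ P' hP' e he
  exact ⟨ΩK, Ωp, Q, hΩK, hΩp, hQ, hdiv⟩

omit [W.IsElliptic] [W.IsGloballyMinimal] in
/-- **A prime-blind supplier serves (2.4)∃♭ᴮ**: a frame dividing `Ch_Λ(X_ac 𝔮)` at EVERY `𝔮 ∋ p` gives the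
oriented atom (take `𝔮 := 𝔭bar`) — and, verbatim, the A-atom. Nothing asserted. [folklore] -/
theorem P2.imcDivSomeFrameOnTreeB_of_forall_prime
    (h : ∀ (N : ℕ) [NeZero N] (K : Type) [Field K] [NumberField K]
      (Dt : ModularParametrizationData W N) (H : HeegnerDatum N (NumberField.discr K)) (ι : K →+* ℂ)
      (P : (W.baseChange K).toAffine.Point),
      ClassX11b W p → 5 ≤ p → Surj W p → W.conductorNorm ℤ = N → IsImaginaryQuadratic K →
      Odd (NumberField.discr K) → ¬ (p : ℤ) ∣ NumberField.discr K → ¬ p ∣ Units.torsionOrder K →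
      SatisfiesHeegnerHypothesis N K →
      (W.quadraticTwist (NumberField.discr K : ℚ)).entireLFunction 1 ≠ 0 →
      WeierstrassCurve.Affine.Point.map ι.toRatAlgHom P = heegnerPointComplex Dt H →
      ¬ (p : ℤ) ∣ Dt.c → ¬ IsOfFinAddOrder P →
      ∀ (κ : ZpExtension K p), κ.IsAnticyclotomic →
        ∀ (γ : Field.absoluteGaloisGroup K) [Fact (κ.IsTopGenerator γ)]
          (ι' : PadicAlgCl p ≃+* ℂ) (w₀ : InfinitePlace K) (P' : (W.baseChange K).toAffine.Point),
          WeierstrassCurve.Affine.Point.map w₀.embedding.toRatAlgHom P' = heegnerPointComplex Dt H →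
          ∀ (e : K →+* ℚ_[p]),
            (∀ k : 𝓞 K, k ∈ (primeOfEmbeddingDatum p ι' w₀.embedding).asIdeal ↔ ‖e (k : K)‖ < 1) →
            ∃ (ΩK : ℂ) (Ωp : ℂ_[p]) (Q : PowerSeries 𝓞_ℂ_[p]), ΩK ≠ 0 ∧ ‖Ωp‖ = 1 ∧
              R1.IsBDPLFunctionInt p ι' (primeOfEmbeddingDatum p ι' w₀.embedding) κ γ Dt.f ΩK Ωp Q ∧
              ∀ (𝔮 : HeightOneSpectrum (𝓞 K)), ((p : ℕ) : 𝓞 K) ∈ 𝔮.asIdeal →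
                (XAc.charIdeal (W.baseChange K) p κ 𝔮 ∅ γ).map (PowerSeries.map (R1.toCpInt p)) ≤
                  Ideal.span {Q}) :
    P2.IMCDivSomeFrameOnTreeB W p := by
  intro N _ K _ _ Dt H ι P hX h5 hs hN hK hodd hpd hμ hHN hLt hP hc hPinf κ hκ γ _ ι' w₀ P' hP' e he
  obtain ⟨ΩK, Ωp, Q, hΩK, hΩp, hQ, hdiv⟩ :=
    h N K Dt H ι P hX h5 hs hN hK hodd hpd hμ hHN hLt hP hc hPinf κ hκ γ ι' w₀ P' hP' e he
  exact ⟨ΩK, Ωp, Q, hΩK, hΩp, hQ, fun 𝔭bar h𝔭bar _ ↦ hdiv 𝔭bar h𝔭bar⟩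

end Weaker

end Summit.BirchSwinnertonDyer.Rank1Residual.X11b

end
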